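import Literature.Computability.MetaComplexity.EFModMulULeib
import HarnessLib

/-!
# The range law of uniform modular multiplication in extended Frege

Layer E/3 (uniform variant). The multiplier WITH its range certificates, `ModMulU.mulRT L`: a
layout of the multiplier `ModMulU.mulT L` followed by `3L + 2` comparators with `n` — of `a`,
of the zero word, and per stage of the doubled word `R(D_s)`, the mask `mk_s` and the partial
product `P_{s+1}` — and the **range law** (`ModMulU.RView.isBlock_rangeLines`): from `a < n`
every one of these words is provably `< n` (the comparators answer `<`), by the range law of
modular addition (`ModAddU.LtData.isBlock_lines`) stage by stage, the tiny carry systems `ZLT`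
(`0 < n`) and `MLT` (`(b ∧ a) < n`), and an induction over the stages in the metalanguage.
The generic **high-bits block** (`ModMulU.isBlock_highLines`): a word `< n` whose modulus has
provably false bits from position `m` on has provably false bits from `m` on (read off the
comparison carries from the top).

## Sources

* S. A. Cook, R. A. Reckhow, *The relative efficiency of propositional proof systems*,
  J. Symbolic Logic 44 (1979), §2 (sound schematic rules).
* J. Krajíček, *Bounded Arithmetic, Propositional Logic, and Complexity Theory* (CUP 1995), §9.2.
-/

namespace Literature.Computability.MetaComplexity

open _root_.Computability Complexity Complexity.PropForm Netlist Cluster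

namespace ModMulU

/-! ### Rules and systems -/

/-- From `ge' ↔ maj(x, ny, ge)`, `ny ↔ ¬y`, `¬y`, `¬ge'`: `¬x`. [cite: CookReckhow1979, §2 (sound rule)] -/
def rH1 : FregeRule :=
  ⟨[ctx (var 0) (biimp (var 1) (majF (var 2) (var 3) (var 4))), ctx (var 0) (biimp (var 3) (neg (var 5))),
    ctx (var 0) (neg (var 5)), ctx (var 0) (neg (var 1))], ctx (var 0) (neg (var 2))⟩
/-- From the same premises: `¬ge`. [cite: CookReckhow1979, §2 (sound rule)] -/
def rH2 : FregeRule :=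
  ⟨[ctx (var 0) (biimp (var 1) (majF (var 2) (var 3) (var 4))), ctx (var 0) (biimp (var 3) (neg (var 5))),
    ctx (var 0) (neg (var 5)), ctx (var 0) (neg (var 1))], ctx (var 0) (neg (var 4))⟩

/-- **System `ZLT`**: the zero word compared with `n`, against `a` compared with `n`: `a < n` gives `0 < n` (end rule).
Leaves: 1 ze, 2 al, 3 a, 4 n; defined: 5 zv, 6 nZ, 7 ze2, 8 nA, 9 al2. Invariant: the reachable carry states (2 terms). [folklore] -/
def ZLT : System where
  cins := [biimp (var 1) (const true), biimp (var 2) (const true)]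
  shapes := [biimp (var 5) (const false),
    biimp (var 6) (neg (var 4)),
    biimp (var 7) (majF (var 5) (var 6) (var 1)),
    biimp (var 8) (neg (var 4)),
    biimp (var 9) (majF (var 3) (var 8) (var 2))]
  inv := (disj (neg (var 1)) (var 2))
  next := fun k => if k = 1 then 7 else if k = 2 then 9 else k

/-- End rule of `ZLT`: `¬α` gives `¬ζ`. [cite: CookReckhow1979, §2 (sound rule)] -/
def rZLTEnd : FregeRule := ZLT.endRule [neg (var 2)] (neg (var 1))

/-- **System `MLT`**: the mask `bs ∧ a` compared with `n`, against `a` compared with `n`: `a < n` gives `(bs ∧ a) < n` (end rule).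
Leaves: 1 mu, 2 al, 3 bs, 4 a, 5 n; defined: 6 nM, 7 mk, 8 mu2, 9 nA, 10 al2. Invariant: the reachable carry states (3 terms). [folklore] -/
def MLT : System where
  cins := [biimp (var 1) (const true), biimp (var 2) (const true)]
  shapes := [biimp (var 6) (neg (var 5)),
    biimp (var 7) (conj (var 3) (var 4)),
    biimp (var 8) (majF (var 7) (var 6) (var 1)),
    biimp (var 9) (neg (var 5)),
    biimp (var 10) (majF (var 4) (var 9) (var 2))]
  inv := (disj (conj (neg (var 1)) (neg (var 2))) (disj (conj (var 1) (var 2)) (conj (var 2) (neg (var 3)))))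
  next := fun k => if k = 1 then 8 else if k = 2 then 10 else k

/-- End rule of `MLT`: `¬α` gives `¬μ`. [cite: CookReckhow1979, §2 (sound rule)] -/
def rMLTEnd : FregeRule := MLT.endRule [neg (var 2)] (neg (var 1))

/-- The rules of the range layer. [cite: CookReckhow1979, §2] -/
def rangeRules : List FregeRule := [ZLT.baseRule, ZLT.stepRule, rZLTEnd, MLT.baseRule, MLT.stepRule, rMLTEnd, rH1, rH2]

/-- Every rule of the range layer is sound (truth tables). [cite: CookReckhow1979, §2 (sound rule)] -/
theorem isSound_of_mem_rangeRules : ∀ r ∈ rangeRules, r.IsSound := by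
  intro r hr
  simp only [rangeRules, List.mem_cons, List.not_mem_nil, or_false] at hr
  rcases hr with rfl | rfl | rfl | rfl | rfl | rfl | rfl | rfl
  · exact FregeRule.isSound_of_check (by decide +kernel)
  · exact FregeRule.isSound_of_checkD (V := 5) (ds := ZLT.ds) (by decide +kernel)
  · exact FregeRule.isSound_of_check (by decide +kernel)
  · exact FregeRule.isSound_of_check (by decide +kernel)
  · exact FregeRule.isSound_of_checkD (V := 6) (ds := MLT.ds) (by decide +kernel)
  · exact FregeRule.isSound_of_check (by decide +kernel)
  · exact FregeRule.isSound_of_check (by decide +kernel)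
  · exact FregeRule.isSound_of_check (by decide +kernel)

/-- The leaf side conditions of the two systems. [folklore] -/
theorem rangeLeavesOK : ZLT.LeavesOK ∧ MLT.LeavesOK :=
  ⟨System.leavesOK_of_leavesOKB (by decide +kernel), System.leavesOK_of_leavesOKB (by decide +kernel)⟩

/-- Membership in `rangeRules` by position. [folklore] -/
theorem mem_rangeRules {i : ℕ} (hi : i < rangeRules.length) : rangeRules[i] ∈ rangeRules := List.getElem_mem hi

variable {G : FregeSystem} {K : PropForm ℕ} {Γ : Set (PropForm ℕ)}

/-! ### High bits of a word below a small modulus -/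

/-- The lines `¬ge_{L-1}, …, ¬ge_m` of a comparator `C = (x, y)` read from the top. [folklore] -/
def highGeLines (C : Sub.View) (K : PropForm ℕ) (L m : ℕ) : List (PropForm ℕ) :=
  (List.range (L - m)).map fun j => ctx K (neg (var (C.ge L (L - 1 - j))))

/-- The lines `¬x_{L-1}, …, ¬x_m`. [folklore] -/
def highXLines (C : Sub.View) (K : PropForm ℕ) (L m : ℕ) : List (PropForm ℕ) :=
  (List.range (L - m)).map fun j => ctx K (neg (var (C.x (L - 1 - j))))

/-- All high lines. [folklore] -/
def highLines (C : Sub.View) (K : PropForm ℕ) (L m : ℕ) : List (PropForm ℕ) :=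
  highGeLines C K L m ++ highXLines C K L m

/-- **High bits of a word below a small modulus**: if the comparator `C = (x, y)` answers `x < y`
and the bits of `y` are provably false from position `m` on, then so are the bits of `x` (and
the comparison carries). [cite: CookReckhow1979, §2] -/
theorem isBlock_highLines (hG : ∀ r ∈ rangeRules, r ∈ G.rules) {C : Sub.View} {L m : ℕ} {T : Set (PropForm ℕ)}
    (hC : C.Avail K T L) (hy : ∀ i, m ≤ i → i < L → ctx K (neg (var (C.y i))) ∈ T)
    (hlt : ctx K (neg (var (C.ge L L))) ∈ T) : G.IsBlock T (highLines C K L m) := by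
  have hge : G.IsBlock T (highGeLines C K L m) := by
    refine isBlock_map_range (L - m) fun j hj => Or.inr ?_
    have hi : L - 1 - j < L := by omega
    refine FregeSystem.IsInferredFrom.of_rule (hG _ (mem_rangeRules (i := 7) (by decide)))
      (FregeSystem.sub [K, var (C.ge L (L - 1 - j + 1)), var (C.x (L - 1 - j)), var (C.ny (L - 1 - j)),
        var (C.ge L (L - 1 - j)), var (C.y (L - 1 - j))]) rfl
      (FregeSystem.prems_cons (Or.inl (hC.2.2 _ hi).2) (FregeSystem.prems_cons (Or.inl (hC.1 _ hi))
        (FregeSystem.prems_cons (Or.inl (hy _ (by omega) hi)) (FregeSystem.prems_cons ?_ FregeSystem.prems_nil))))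
    rcases Nat.eq_zero_or_pos j with rfl | hj0
    · rw [show L - 1 - 0 + 1 = L by omega]; exact Or.inl hlt
    · refine Or.inr ⟨j - 1, by omega, ?_⟩
      show _ = ctx K (neg (var (C.ge L (L - 1 - (j - 1)))))
      rw [show L - 1 - j + 1 = L - 1 - (j - 1) by omega]; rfl
  refine hge.append (Scaffold.isBlock_of_forall fun θ hθ => ?_)
  obtain ⟨j, hj, rfl⟩ := List.mem_map.1 hθ
  rw [List.mem_range] at hj
  have hi : L - 1 - j < L := by omega
  refine Or.inr (FregeSystem.IsInferredFrom.of_rule (hG _ (mem_rangeRules (i := 6) (by decide)))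
    (FregeSystem.sub [K, var (C.ge L (L - 1 - j + 1)), var (C.x (L - 1 - j)), var (C.ny (L - 1 - j)),
      var (C.ge L (L - 1 - j)), var (C.y (L - 1 - j))]) rfl
    (FregeSystem.prems_cons (Or.inl (hC.2.2 _ hi).2) (FregeSystem.prems_cons (Or.inl (hC.1 _ hi))
      (FregeSystem.prems_cons (Or.inl (hy _ (by omega) hi)) (FregeSystem.prems_cons ?_ FregeSystem.prems_nil)))))
  rcases Nat.eq_zero_or_pos j with rfl | hj0
  · rw [show L - 1 - 0 + 1 = L by omega]; exact Or.inl hlt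
  · refine Or.inr (List.mem_map.2 ⟨j - 1, List.mem_range.2 (by omega), ?_⟩)
    rw [show L - 1 - (j - 1) = L - 1 - j + 1 by omega]; rfl

/-- The conclusions of the high lines: `¬x_i` for `m ≤ i < L`. [folklore] -/
theorem mem_highLines {C : Sub.View} {K : PropForm ℕ} {L m i : ℕ} (hm : m ≤ i) (hi : i < L) :
    ctx K (neg (var (C.x i))) ∈ highLines C K L m :=
  List.mem_append_right _ (List.mem_map.2 ⟨L - 1 - i, List.mem_range.2 (by omega), by
    rw [show L - 1 - (L - 1 - i) = i by omega]⟩)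

/-- Size of the high lines. [folklore] -/
theorem proofSize_highLines (C : Sub.View) (K : PropForm ℕ) (L m : ℕ) :
    proofSize (highLines C K L m) ≤ 2 * L * (K.size + 3) := by
  rw [highLines, proofSize_append]
  have h₁ : proofSize (highGeLines C K L m) ≤ (L - m) * (K.size + 3) :=
    proofSize_map_range_le fun j _ => by simp [ctx, size]
  have h₂ : proofSize (highXLines C K L m) ≤ (L - m) * (K.size + 3) :=
    proofSize_map_range_le fun j _ => by simp [ctx, size]
  have h₃ : (L - m) * (K.size + 3) ≤ L * (K.size + 3) := Nat.mul_le_mul_right _ (Nat.sub_le L m)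
  have h₄ : 2 * L * (K.size + 3) = L * (K.size + 3) + L * (K.size + 3) := by ring
  omega

/-! ### The multiplier with its range certificates -/

/-- The length of the bare multiplier. [folklore] -/
def ML (L : ℕ) : ℕ := 1 + L * (13 * L + 4)

/-- The minuend reference of comparator `k ≥ 1`: `a` (`k = 1`), the zero word (`k = 2`), and
for `k = 3 + 3s + r`: `R(D_s)` (`r = 0`), `mk_s` (`r = 1`), `P_{s+1} = R(A_s)` (`r = 2`). [folklore] -/
def xRef (L k i : ℕ) : ℕ ⊕ ℕ :=
  if k = 1 then Sum.inl i else if k = 2 then Sum.inr 0 else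
    if (k - 3) % 3 = 0 then Sum.inr (offD L ((k - 3) / 3) + (5 * L + 2) + i)
    else if (k - 3) % 3 = 1 then Sum.inr (offM L ((k - 3) / 3) + i)
    else Sum.inr (offA L ((k - 3) / 3) + (5 * L + 2) + i)

/-- Wiring of comparator `k`: minuend by `xRef`, subtrahend `n`. [folklore] -/
def cw (L k : ℕ) (i : ℕ) : ℕ ⊕ ℕ := if i < L then xRef L k i else Sum.inl (L + i)

/-- The pieces of the certified multiplier: the multiplier, then the comparators. [cite: Vollmer1999, §1.2] -/
def rpieces (L : ℕ) (k : ℕ) : Piece := if k = 0 then ⟨mulT L, 3 * L, Sum.inl⟩ else ⟨Sub.subT L, 2 * L, cw L k⟩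

/-- Closed-form offsets of the certified multiplier. [folklore] -/
def roff (L k : ℕ) : ℕ := if k = 0 then 0 else ML L + (k - 1) * (3 * L + 1)

/-- **The certified multiplier**: the multiplier followed by `3L + 2` comparators with `n`.
[cite: Vollmer1999, §1.2–1.3] -/
def mulRT (L : ℕ) : Template := layout (rpieces L) (3 * L + 3)

/-- The offsets are the closed forms. [folklore] -/
theorem offset_rpieces (L : ℕ) : ∀ k, offset (rpieces L) k = roff L k := by
  intro k
  induction k with
  | zero => rfl
  | succ k ih =>
    rw [offset_succ, ih]
    unfold roff rpieces
    rcases Nat.eq_zero_or_pos k with rfl | hk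
    · simp [ML]
    · rw [if_neg (by omega), if_neg (by omega), if_neg (by omega), Sub.length_subT, show k + 1 - 1 = k - 1 + 1 by omega]
      ring

/-- Length of the certified multiplier. [folklore] -/
@[simp] theorem length_mulRT (L : ℕ) : (mulRT L).length = ML L + (3 * L + 2) * (3 * L + 1) := by
  rw [mulRT, length_layout, offset_rpieces]; unfold roff; rw [if_neg (by omega)]; rfl

/-- A gate reference of the comparators points into the multiplier. [folklore] -/
theorem xRef_lt {L k i g : ℕ} (hk : 3 ≤ k) (hkL : k < 3 * L + 3) (hi : i < L) (h : xRef L k i = Sum.inr g) : g < ML L := by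
  unfold xRef at h
  rw [if_neg (by omega), if_neg (by omega)] at h
  have hs : (k - 3) / 3 + 1 ≤ L := by omega
  have e := Nat.mul_le_mul_right (13 * L + 4) hs
  have e2 : ((k - 3) / 3 + 1) * (13 * L + 4) = (k - 3) / 3 * (13 * L + 4) + (13 * L + 4) := by ring
  unfold ML
  split_ifs at h <;> cases h <;> simp only [offD, offM, offA] <;> omega

/-- Every piece is well formed and well wired. [cite: Vollmer1999, Def. 1.6] -/
theorem rpiece_ok (L : ℕ) : ∀ k < 3 * L + 3, Piece.OK (rpieces L) (3 * L) k := by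
  intro k hk
  unfold Piece.OK
  rw [offset_rpieces]
  unfold rpieces roff
  rcases Nat.eq_zero_or_pos k with rfl | hk0
  · simp only [if_true]
    exact ⟨wf_mulT L, fun i hi => ⟨fun a ha => by cases ha; exact hi, fun g hg => by cases hg⟩⟩
  · rw [if_neg (by omega), if_neg (by omega)]
    refine ⟨Sub.wf_subT L, fun i hi => ?_⟩
    simp only at hi ⊢
    unfold cw
    split_ifs with h1
    · refine ⟨fun a ha => ?_, fun g hg => ?_⟩
      · unfold xRef at ha
        split_ifs at ha with h2
        cases ha; omega
      · rcases Nat.lt_or_ge k 3 with hk3 | hk3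
        · unfold xRef at hg
          have : k = 1 ∨ k = 2 := by omega
          rcases this with rfl | rfl
          · simp at hg
          · simp only [show (2 : ℕ) ≠ 1 from by decide, if_false, if_true, Sum.inr.injEq] at hg
            subst hg; unfold ML; omega
        · have := xRef_lt hk3 hk h1 hg; omega
    · exact ⟨fun a ha => (by cases ha; omega), fun g hg => by cases hg⟩

/-- **The certified multiplier is well formed** (`3L` inputs). [cite: Vollmer1999, Def. 1.6] -/
theorem wf_mulRT (L : ℕ) : (mulRT L).WF (3 * L) := wf_layout (rpieces L) (rpiece_ok L)

/-! ### The comparators of a view -/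

namespace View

variable (V : View) (L : ℕ)

/-- The base of comparator `k ≥ 1`. [folklore] -/
def rbase (k : ℕ) : ℕ := V.base + (ML L + (k - 1) * (3 * L + 1))
/-- The comparator of `a`. [folklore] -/
def CA : Sub.View := ⟨V.rbase L 1, V.a, V.n⟩
/-- The comparator of the zero word. [folklore] -/
def CZ : Sub.View := ⟨V.rbase L 2, fun _ => V.z, V.n⟩
/-- The comparator of the doubled word `R(D_s)`. [folklore] -/
def CD (s : ℕ) : Sub.View := ⟨V.rbase L (3 + 3 * s), (V.Dv L s).R L, V.n⟩
/-- The comparator of the mask `mk_s`. [folklore] -/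
def CM (s : ℕ) : Sub.View := ⟨V.rbase L (4 + 3 * s), V.msk L s, V.n⟩
/-- The comparator of `P_{s+1} = R(A_s)`. [folklore] -/
def CPp (s : ℕ) : Sub.View := ⟨V.rbase L (5 + 3 * s), (V.Av L s).R L, V.n⟩
/-- The base of the comparator of `P_s`. [folklore] -/
def bCP (s : ℕ) : ℕ := if s = 0 then V.rbase L 2 else V.rbase L (5 + 3 * (s - 1))
/-- The comparator of `P_s` (the zero-word comparator for `s = 0`). [folklore] -/
def CP (s : ℕ) : Sub.View := ⟨V.bCP L s, V.P L s, V.n⟩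

/-- `V.RAvail L K Γ`: the multiplier and all its comparators are available. [folklore] -/
structure RAvail (K : PropForm ℕ) (Γ : Set (PropForm ℕ)) : Prop where
  /-- the multiplier -/
  hV : V.Avail L K Γ
  /-- the comparator of `a` -/
  hCA : (V.CA L).Avail K Γ L
  /-- the comparator of the zero word -/
  hCZ : (V.CZ L).Avail K Γ L
  /-- the comparators of the doubled words -/
  hCD : ∀ s < L, (V.CD L s).Avail K Γ L
  /-- the comparators of the masks -/
  hCM : ∀ s < L, (V.CM L s).Avail K Γ L
  /-- the comparators of the partial products -/
  hCPp : ∀ s < L, (V.CPp L s).Avail K Γ L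

/-- Availability is monotone. [folklore] -/
theorem RAvail.mono {V : View} {L : ℕ} {K : PropForm ℕ} {Γ Γ' : Set (PropForm ℕ)} (h : V.RAvail L K Γ) (hΓ : Γ ⊆ Γ') :
    V.RAvail L K Γ' :=
  ⟨h.hV.mono hΓ, h.hCA.mono hΓ, h.hCZ.mono hΓ, fun s hs => (h.hCD s hs).mono hΓ, fun s hs => (h.hCM s hs).mono hΓ,
    fun s hs => (h.hCPp s hs).mono hΓ⟩

/-- The comparator of `P_s` is available. [folklore] -/
theorem RAvail.hCP {V : View} {L : ℕ} {K : PropForm ℕ} {Γ : Set (PropForm ℕ)} (h : V.RAvail L K Γ) {s : ℕ} (hs : s ≤ L) :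
    (V.CP L s).Avail K Γ L := by
  rcases Nat.eq_zero_or_pos s with rfl | hs0
  · exact h.hCZ.congr (by simp [CP, bCP, CZ]) (fun i _ => rfl) (fun i _ => rfl)
  · obtain ⟨t, rfl⟩ : ∃ t, s = t + 1 := ⟨s - 1, by omega⟩
    exact (h.hCPp t (by omega)).congr (by simp [CP, bCP, CPp]) (fun i _ => V.P_succ L t i) (fun i _ => rfl)

/-- Availability of a multiplier view transfers along pointwise equal operand words. [folklore] -/
theorem Avail.congr {V V' : View} {L : ℕ} {K : PropForm ℕ} {Γ : Set (PropForm ℕ)} (h : V.Avail L K Γ)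
    (hb0 : V'.base = V.base) (ha : ∀ i < L, V'.a i = V.a i) (hb : ∀ i < L, V'.b i = V.b i)
    (hn : ∀ i < L, V'.n i = V.n i) : V'.Avail L K Γ := by
  obtain ⟨base, a, b, n⟩ := V
  obtain ⟨base', a', b', n'⟩ := V'
  simp only at hb0 ha hb hn
  subst hb0
  refine ⟨h.hz, fun s hs => (h.hD s hs).congr rfl (fun i _ => rfl) (fun i _ => rfl) hn, fun s hs i hi => ?_,
    fun s hs => (h.hA s hs).congr rfl (fun i _ => rfl) (fun i _ => rfl) hn⟩
  have := h.hmk s hs i hi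
  simp only [mkDef, msk] at this ⊢
  rw [ha i hi, hb _ (by omega)]
  exact this

end View

/-! ### Availability from an occurrence of the certified multiplier -/

variable {L : ℕ} {o : Occ}

/-- The piece of a comparator. [folklore] -/
theorem rpieces_pos {k : ℕ} (hk : 0 < k) : rpieces L k = ⟨Sub.subT L, 2 * L, cw L k⟩ := by
  unfold rpieces; rw [if_neg (by omega)]

/-- The comparator occurrence `k ≥ 1` is available. [folklore] -/
theorem avail_cmp (ho : o.Avail (mulRT L) (3 * L) K Γ) {k : ℕ} (hk : 0 < k) (hk' : k < 3 * L + 3) :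
    (Sub.viewOf ((pieceOcc (o.inst (3 * L)) (rpieces L) k).inst (2 * L)) L).Avail K Γ L := by
  have hq : (pieceOcc (o.inst (3 * L)) (rpieces L) k).Avail (Sub.subT L) (2 * L) K Γ := by
    have := Inst.DefsAvail.piece ho (k := k) hk' (by rw [rpieces_pos hk]; exact Sub.wf_subT L)
    rw [rpieces_pos hk] at this; exact this
  exact Sub.avail_viewOf hq

/-- The base of the comparator occurrence `k`. [folklore] -/
theorem base_cmp {k : ℕ} (hk : 0 < k) :
    (Sub.viewOf ((pieceOcc (o.inst (3 * L)) (rpieces L) k).inst (2 * L)) L).base = (viewOf o L).rbase L k := by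
  simp [Sub.viewOf, pieceOcc, offset_rpieces, roff, Nat.pos_iff_ne_zero.1 hk, View.rbase, viewOf]

/-- The subtrahend of the comparator occurrence `k` is `n`. [folklore] -/
theorem y_cmp {k : ℕ} (hk : 0 < k) {i : ℕ} (hi : i < L) :
    (Sub.viewOf ((pieceOcc (o.inst (3 * L)) (rpieces L) k).inst (2 * L)) L).y i = o.inp (2 * L + i) := by
  simp only [Sub.viewOf]
  rw [Occ.getD_inst _ (show L + i < 2 * L by omega), inp_pieceOcc, rpieces_pos hk]
  show (o.inst (3 * L)).ref (cw L k (L + i)) = _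
  rw [cw, if_neg (by omega), show L + (L + i) = 2 * L + i by ring, Occ.ref_inl _ (by omega)]

/-- The minuend of the comparator occurrence `k` is the referenced word. [folklore] -/
theorem x_cmp {k : ℕ} (hk : 0 < k) {i : ℕ} (hi : i < L) :
    (Sub.viewOf ((pieceOcc (o.inst (3 * L)) (rpieces L) k).inst (2 * L)) L).x i = (o.inst (3 * L)).ref (xRef L k i) := by
  simp only [Sub.viewOf]
  rw [Occ.getD_inst _ (show i < 2 * L by omega), inp_pieceOcc, rpieces_pos hk]
  show (o.inst (3 * L)).ref (cw L k i) = _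
  rw [cw, if_pos hi]

/-- **An available occurrence of the certified multiplier provides an available certified view.**
[folklore] -/
theorem ravail_ofOcc (ho : o.Avail (mulRT L) (3 * L) K Γ) : (viewOf o L).RAvail L K Γ := by
  have hL : 0 < 3 * L + 3 := by omega
  refine ⟨?_, ?_, ?_, fun s hs => ?_, fun s hs => ?_, fun s hs => ?_⟩
  · -- the multiplier: piece 0
    have h0 : (pieceOcc (o.inst (3 * L)) (rpieces L) 0).Avail (mulT L) (3 * L) K Γ :=
      Inst.DefsAvail.piece ho (k := 0) hL (wf_mulT L)
    refine (avail_ofOcc h0).congr ?_ (fun i hi => ?_) (fun i hi => ?_) (fun i hi => ?_)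
    · simp [viewOf, pieceOcc]
    · show o.inp i = (pieceOcc (o.inst (3 * L)) (rpieces L) 0).inp i
      rw [inp_pieceOcc]; show _ = (o.inst (3 * L)).ref (Sum.inl i); rw [Occ.ref_inl _ (by omega)]
    · show o.inp (L + i) = (pieceOcc (o.inst (3 * L)) (rpieces L) 0).inp (L + i)
      rw [inp_pieceOcc]; show _ = (o.inst (3 * L)).ref (Sum.inl (L + i)); rw [Occ.ref_inl _ (by omega)]
    · show o.inp (2 * L + i) = (pieceOcc (o.inst (3 * L)) (rpieces L) 0).inp (2 * L + i)
      rw [inp_pieceOcc]; show _ = (o.inst (3 * L)).ref (Sum.inl (2 * L + i)); rw [Occ.ref_inl _ (by omega)]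
  · refine (avail_cmp ho (k := 1) (by omega) (by omega)).congr (base_cmp (by omega)).symm (fun i hi => ?_)
      (fun i hi => (y_cmp (by omega) hi).symm)
    rw [x_cmp (by omega) hi]; show o.inp i = (o.inst (3 * L)).ref (Sum.inl i); rw [Occ.ref_inl _ (by omega)]
  · refine (avail_cmp ho (k := 2) (by omega) (by omega)).congr (base_cmp (by omega)).symm (fun i hi => ?_)
      (fun i hi => (y_cmp (by omega) hi).symm)
    rw [x_cmp (by omega) hi]; show o.base = (o.inst (3 * L)).ref (Sum.inr 0); rw [Occ.ref_inr]; simp [Occ.wire]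
  · refine (avail_cmp ho (k := 3 + 3 * s) (by omega) (by omega)).congr (base_cmp (by omega)).symm (fun i hi => ?_)
      (fun i hi => (y_cmp (by omega) hi).symm)
    rw [x_cmp (by omega) hi]
    show (viewOf o L).base + offD L s + (5 * L + 2) + i = (o.inst (3 * L)).ref (xRef L (3 + 3 * s) i)
    unfold xRef
    rw [if_neg (by omega), if_neg (by omega), if_pos (by omega), show (3 + 3 * s - 3) / 3 = s by omega, Occ.ref_inr]
    simp [viewOf, Occ.wire, Nat.add_assoc]
  · refine (avail_cmp ho (k := 4 + 3 * s) (by omega) (by omega)).congr (base_cmp (by omega)).symm (fun i hi => ?_)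
      (fun i hi => (y_cmp (by omega) hi).symm)
    rw [x_cmp (by omega) hi]
    show (viewOf o L).base + offM L s + i = (o.inst (3 * L)).ref (xRef L (4 + 3 * s) i)
    unfold xRef
    rw [if_neg (by omega), if_neg (by omega), if_neg (by omega), if_pos (by omega), show (4 + 3 * s - 3) / 3 = s by omega,
      Occ.ref_inr]
    simp [viewOf, Occ.wire, Nat.add_assoc]
  · refine (avail_cmp ho (k := 5 + 3 * s) (by omega) (by omega)).congr (base_cmp (by omega)).symm (fun i hi => ?_)
      (fun i hi => (y_cmp (by omega) hi).symm)
    rw [x_cmp (by omega) hi]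
    show (viewOf o L).base + offA L s + (5 * L + 2) + i = (o.inst (3 * L)).ref (xRef L (5 + 3 * s) i)
    unfold xRef
    rw [if_neg (by omega), if_neg (by omega), if_neg (by omega), if_neg (by omega), show (5 + 3 * s - 3) / 3 = s by omega,
      Occ.ref_inr]
    simp [viewOf, Occ.wire, Nat.add_assoc]

/-! ### The range law -/

namespace View

variable (V : View) (L : ℕ)

/-- Leaf assignment of `ZLT`. [folklore] -/
def actZ (i : ℕ) (k : ℕ) : ℕ :=
  [0, (V.CZ L).ge L i, (V.CA L).ge L i, V.a i, V.n i, V.z, (V.CZ L).ny i, (V.CZ L).ge L (i + 1), (V.CA L).ny i,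
    (V.CA L).ge L (i + 1)].getD k 0

/-- Leaf assignment of `MLT` at stage `s`. [folklore] -/
def actM (s : ℕ) (i : ℕ) (k : ℕ) : ℕ :=
  [0, (V.CM L s).ge L i, (V.CA L).ge L i, V.b (L - 1 - s), V.a i, V.n i, (V.CM L s).ny i, V.msk L s i,
    (V.CM L s).ge L (i + 1), (V.CA L).ny i, (V.CA L).ge L (i + 1)].getD k 0

/-- The range data of the doubling adder of stage `s`. [folklore] -/
def ltD (s : ℕ) : ModAddU.LtData := ⟨V.Dv L s, L, V.bCP L s, V.bCP L s, V.rbase L (3 + 3 * s)⟩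
/-- The range data of the accumulating adder of stage `s`. [folklore] -/
def ltA (s : ℕ) : ModAddU.LtData := ⟨V.Av L s, L, V.rbase L (3 + 3 * s), V.rbase L (4 + 3 * s), V.rbase L (5 + 3 * s)⟩

/-- The lines of the zero word: `0 < n`. [folklore] -/
def zeroLines (K : PropForm ℕ) : List (PropForm ℕ) :=
  ZLT.lines K (V.actZ L) L ++ [ctx K (neg (var ((V.CZ L).ge L L)))]

/-- The lines of stage `s`: `R(D_s) < n`, `mk_s < n`, `P_{s+1} < n`. [folklore] -/
def stageR (K : PropForm ℕ) (s : ℕ) : List (PropForm ℕ) :=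
  (V.ltD L s).lines K ++ (MLT.lines K (V.actM L s) L ++ ([ctx K (neg (var ((V.CM L s).ge L L)))] ++ (V.ltA L s).lines K))

/-- The range lines up to stage `s`. [folklore] -/
def rUpTo (K : PropForm ℕ) : ℕ → List (PropForm ℕ)
  | 0 => V.zeroLines L K
  | s + 1 => rUpTo K s ++ V.stageR L K s

/-- **The range lines** of the certified multiplier. [folklore] -/
def rangeLines (K : PropForm ℕ) : List (PropForm ℕ) := V.rUpTo L K L

variable {V L}

/-- `P_s < n` is among the lines up to `s`. [folklore] -/
theorem mem_rUpTo_P (s : ℕ) : ctx K (neg (var ((V.CP L s).ge L L))) ∈ V.rUpTo L K s := by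
  cases s with
  | zero => exact List.mem_append_right _ (List.mem_singleton_self _)
  | succ s => exact List.mem_append_right _ (List.mem_append_right _ (List.mem_append_right _
      (List.mem_append_right _ (V.ltA L s).mem_lines)))

/-- `R(D_s) < n` is among the lines of stage `s`. [folklore] -/
theorem mem_stageR_D (s : ℕ) : ctx K (neg (var ((V.CD L s).ge L L))) ∈ V.stageR L K s :=
  List.mem_append_left _ (V.ltD L s).mem_lines

/-- `mk_s < n` is among the lines of stage `s`. [folklore] -/
theorem mem_stageR_M (s : ℕ) : ctx K (neg (var ((V.CM L s).ge L L))) ∈ V.stageR L K s :=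
  List.mem_append_right _ (List.mem_append_right _ (List.mem_append_left _ (List.mem_singleton_self _)))

/-- Earlier prefixes are contained in later ones. [folklore] -/
theorem rUpTo_subset {s t : ℕ} (h : s ≤ t) : ∀ χ ∈ V.rUpTo L K s, χ ∈ V.rUpTo L K t := by
  induction h with
  | refl => exact fun χ hχ => hχ
  | step _ ih => exact fun χ hχ => List.mem_append_left _ (ih χ hχ)

/-- The stage lines are in the range lines. [folklore] -/
theorem stageR_subset {s : ℕ} (hs : s < L) : ∀ χ ∈ V.stageR L K s, χ ∈ V.rangeLines L K := fun χ hχ =>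
  rUpTo_subset (show s + 1 ≤ L by omega) χ (List.mem_append_right _ hχ)

/-- **The zero word is `< n`** (system `ZLT` and its end rule, from `a < n`). [cite: CookReckhow1979, §2] -/
theorem isBlock_zeroLines (hG : ∀ r ∈ rangeRules, r ∈ G.rules) (h : V.RAvail L K Γ)
    (ha : ctx K (neg (var ((V.CA L).ge L L))) ∈ Γ) : G.IsBlock Γ (V.zeroLines L K) := by
  obtain ⟨okZ, -⟩ := rangeLeavesOK
  have h₁ : G.IsBlock Γ (ZLT.lines K (V.actZ L) L) :=
    System.isBlock_lines okZ (hG _ (mem_rangeRules (i := 0) (by decide))) (hG _ (mem_rangeRules (i := 1) (by decide)))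
      K (V.actZ L) L
      (ModAddU.hcoh_of (p := fun k => decide (1 ≤ k ∧ k ≤ 2)) (by decide +kernel) fun i _ k hk => by
        simp only [decide_eq_true_eq] at hk
        obtain ⟨hk₁, hk₂⟩ := hk
        interval_cases k <;> rfl)
      (fun φ hφ => by
        simp only [ZLT, List.mem_cons, List.not_mem_nil, or_false] at hφ
        rcases hφ with rfl | rfl
        exacts [h.hCZ.2.1, h.hCA.2.1])
      (fun i hi φ hφ => by
        simp only [ZLT, List.mem_cons, List.not_mem_nil, or_false] at hφ
        rcases hφ with rfl | rfl | rfl | rfl | rfl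
        exacts [h.hV.hz, h.hCZ.1 i hi, (h.hCZ.2.2 i hi).2, h.hCA.1 i hi, (h.hCA.2.2 i hi).2])
  refine h₁.append (FregeSystem.IsBlock.singleton (Or.inr ?_))
  exact System.isInferredFrom_end okZ.inv_ne_zero (hG _ (mem_rangeRules (i := 2) (by decide)))
    (System.forall_ne_zero_of_shapesOKB (by decide +kernel)) (ModAddU.ne_zero_of_allVarsB (by decide +kernel)) K (V.actZ L) L
    (Or.inr (System.mem_lines ZLT K (V.actZ L) le_rfl)) fun φ hφ => by
      rw [List.mem_singleton.1 hφ]; exact Or.inl ha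

/-- **Stage `s` of the range law**: from `P_s < n` (and `a < n`), `R(D_s) < n`, `mk_s < n` and
`P_{s+1} < n`. [cite: CookReckhow1979, §2] -/
theorem isBlock_stageR (hG : ∀ r ∈ rangeRules, r ∈ G.rules) (hGM : ∀ r ∈ ModAddU.rules, r ∈ G.rules)
    (hGA : ∀ r ∈ Adder.rules, r ∈ G.rules) {T : Set (PropForm ℕ)} (h : V.RAvail L K T)
    (ha : ctx K (neg (var ((V.CA L).ge L L))) ∈ T) {s : ℕ} (hs : s < L) (hP : ctx K (neg (var ((V.CP L s).ge L L))) ∈ T) :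
    G.IsBlock T (V.stageR L K s) := by
  obtain ⟨-, okM⟩ := rangeLeavesOK
  -- `R(D_s) < n`
  have h₁ : G.IsBlock T ((V.ltD L s).lines K) :=
    (V.ltD L s).isBlock_lines hGM hGA (h.hV.hD s hs) (h.hCP hs.le) (h.hCP hs.le) (h.hCD s hs) hP hP
  -- `mk_s < n`
  have h₂ : G.IsBlock T (MLT.lines K (V.actM L s) L) :=
    System.isBlock_lines okM (hG _ (mem_rangeRules (i := 3) (by decide))) (hG _ (mem_rangeRules (i := 4) (by decide)))
      K (V.actM L s) L
      (ModAddU.hcoh_of (p := fun k => decide (1 ≤ k ∧ k ≤ 3)) (by decide +kernel) fun i _ k hk => by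
        simp only [decide_eq_true_eq] at hk
        obtain ⟨hk₁, hk₂⟩ := hk
        interval_cases k <;> rfl)
      (fun φ hφ => by
        simp only [MLT, List.mem_cons, List.not_mem_nil, or_false] at hφ
        rcases hφ with rfl | rfl
        exacts [(h.hCM s hs).2.1, h.hCA.2.1])
      (fun i hi φ hφ => by
        simp only [MLT, List.mem_cons, List.not_mem_nil, or_false] at hφ
        rcases hφ with rfl | rfl | rfl | rfl | rfl
        exacts [(h.hCM s hs).1 i hi, h.hV.hmk s hs i hi, ((h.hCM s hs).2.2 i hi).2, h.hCA.1 i hi, (h.hCA.2.2 i hi).2])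
  have h₃ : ∀ T' : Set (PropForm ℕ), T ⊆ T' → MLT.line K (V.actM L s) L ∈ T' →
      G.IsBlock T' [ctx K (neg (var ((V.CM L s).ge L L)))] := fun T' hT hl =>
    FregeSystem.IsBlock.singleton (Or.inr (System.isInferredFrom_end okM.inv_ne_zero
      (hG _ (mem_rangeRules (i := 5) (by decide))) (System.forall_ne_zero_of_shapesOKB (by decide +kernel))
      (ModAddU.ne_zero_of_allVarsB (by decide +kernel)) K (V.actM L s) L hl fun φ hφ => by
        rw [List.mem_singleton.1 hφ]; exact hT ha))
  -- `P_{s+1} < n`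
  have h₄ : ∀ T' : Set (PropForm ℕ), T ⊆ T' → ctx K (neg (var ((V.CD L s).ge L L))) ∈ T' →
      ctx K (neg (var ((V.CM L s).ge L L))) ∈ T' → G.IsBlock T' ((V.ltA L s).lines K) := fun T' hT hd hm =>
    (V.ltA L s).isBlock_lines hGM hGA ((h.hV.hA s hs).mono hT) ((h.hCD s hs).mono hT) ((h.hCM s hs).mono hT)
      ((h.hCPp s hs).mono hT) hd hm
  refine h₁.append ((h₂.mono Set.subset_union_left).append ((h₃ _ ?_ ?_).append (h₄ _ ?_ ?_ ?_)))
  · exact fun χ hχ => Or.inl (Or.inl hχ)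
  · exact Or.inr (System.mem_lines MLT K (V.actM L s) le_rfl)
  · exact fun χ hχ => Or.inl (Or.inl (Or.inl hχ))
  · exact Or.inl (Or.inl (Or.inr (V.ltD L s).mem_lines))
  · exact Or.inr (List.mem_singleton_self _)

/-- **The range law up to stage `s`.** [cite: CookReckhow1979, §2] -/
theorem isBlock_rUpTo (hG : ∀ r ∈ rangeRules, r ∈ G.rules) (hGM : ∀ r ∈ ModAddU.rules, r ∈ G.rules)
    (hGA : ∀ r ∈ Adder.rules, r ∈ G.rules) (h : V.RAvail L K Γ) (ha : ctx K (neg (var ((V.CA L).ge L L))) ∈ Γ) :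
    ∀ s ≤ L, G.IsBlock Γ (V.rUpTo L K s) := by
  intro s hs
  induction s with
  | zero => exact isBlock_zeroLines hG h ha
  | succ s ih =>
    rw [rUpTo]
    exact (ih (by omega)).append (isBlock_stageR hG hGM hGA (h.mono Set.subset_union_left) (Or.inl ha) (by omega)
      (Or.inr (mem_rUpTo_P s)))

/-- **The range law of modular multiplication inside Frege**: from `a < n`, the zero word, every
doubled word `R(D_s)`, every mask `mk_s` and every partial product `P_s` (in particular the
product `a ⊗ b = P_L`) are provably `< n`. [cite: CookReckhow1979, §2; Krajicek1995, §9.2] -/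
theorem isBlock_rangeLines (hG : ∀ r ∈ rangeRules, r ∈ G.rules) (hGM : ∀ r ∈ ModAddU.rules, r ∈ G.rules)
    (hGA : ∀ r ∈ Adder.rules, r ∈ G.rules) (h : V.RAvail L K Γ) (ha : ctx K (neg (var ((V.CA L).ge L L))) ∈ Γ) :
    G.IsBlock Γ (V.rangeLines L K) :=
  isBlock_rUpTo hG hGM hGA h ha L le_rfl

/-- Conclusion: `P_s < n` for `s ≤ L`. [folklore] -/
theorem mem_rangeLines_P {s : ℕ} (hs : s ≤ L) : ctx K (neg (var ((V.CP L s).ge L L))) ∈ V.rangeLines L K :=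
  rUpTo_subset hs _ (mem_rUpTo_P s)

/-- Conclusion: the product is `< n`. [folklore] -/
theorem mem_rangeLines_out : ctx K (neg (var ((V.CP L L).ge L L))) ∈ V.rangeLines L K := mem_rangeLines_P le_rfl

/-- Conclusion: `R(D_s) < n`. [folklore] -/
theorem mem_rangeLines_D {s : ℕ} (hs : s < L) : ctx K (neg (var ((V.CD L s).ge L L))) ∈ V.rangeLines L K :=
  stageR_subset hs _ (mem_stageR_D s)

/-- Conclusion: `mk_s < n`. [folklore] -/
theorem mem_rangeLines_M {s : ℕ} (hs : s < L) : ctx K (neg (var ((V.CM L s).ge L L))) ∈ V.rangeLines L K :=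
  stageR_subset hs _ (mem_stageR_M s)

/-- Size of a stage of the range law. [folklore] -/
theorem proofSize_stageR (s : ℕ) : proofSize (V.stageR L K s) ≤ (3 * L + 8) * (K.size + 153) := by
  simp only [stageR, proofSize_append, proofSize_singleton]
  have h₁ : proofSize ((V.ltD L s).lines K) ≤ (L + 3) * (K.size + 153) := (V.ltD L s).proofSize_lines
  have h₂ : proofSize ((V.ltA L s).lines K) ≤ (L + 3) * (K.size + 153) := (V.ltA L s).proofSize_lines
  have h₃ := System.proofSize_lines MLT K (V.actM L s) L
  have hM : MLT.inv.size = 14 := by decide +kernel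
  rw [hM] at h₃
  simp only [ctx, size]
  nlinarith [h₁, h₂, h₃]

/-- Size of the zero block. [folklore] -/
theorem proofSize_zeroLines : proofSize (V.zeroLines L K) ≤ (L + 2) * (K.size + 10) := by
  rw [zeroLines, proofSize_append, proofSize_singleton]
  have h₁ := System.proofSize_lines ZLT K (V.actZ L) L
  have hZ : ZLT.inv.size = 4 := by decide +kernel
  rw [hZ] at h₁
  simp only [ctx, size]
  nlinarith [h₁]

/-- Size up to stage `s`. [folklore] -/
theorem proofSize_rUpTo : ∀ s, proofSize (V.rUpTo L K s) ≤ (L + 2) * (K.size + 10) + s * ((3 * L + 8) * (K.size + 153))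
  | 0 => by simpa [rUpTo] using (proofSize_zeroLines (V := V) (L := L) (K := K))
  | s + 1 => by
    rw [rUpTo, proofSize_append]
    nlinarith [proofSize_rUpTo s, proofSize_stageR (V := V) (L := L) (K := K) s]

/-- **Size of the range law**: `O(L² · (|K| + 1))`. [folklore] -/
theorem proofSize_rangeLines :
    proofSize (V.rangeLines L K) ≤ (L + 2) * (K.size + 10) + L * ((3 * L + 8) * (K.size + 153)) :=
  proofSize_rUpTo L

/-! ### High bits of all the words of a certified multiplier -/

/-- The high lines of all words of the certified multiplier: the partial products `P_s`
(`s ≤ L`), the doubled words and the masks. [folklore] -/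
def highAll (V : View) (L : ℕ) (K : PropForm ℕ) (m : ℕ) : List (PropForm ℕ) :=
  ((List.range (L + 1)).map fun s => highLines (V.CP L s) K L m).flatten ++
    ((List.range L).map fun s => highLines (V.CD L s) K L m ++ highLines (V.CM L s) K L m).flatten

/-- **All words of a certified multiplier have provably false high bits**, once the range lines
are available and the modulus has provably false bits from `m` on. [cite: CookReckhow1979, §2] -/
theorem isBlock_highAll (hG : ∀ r ∈ rangeRules, r ∈ G.rules) {T : Set (PropForm ℕ)} (h : V.RAvail L K T) {m : ℕ}
    (hn : ∀ i, m ≤ i → i < L → ctx K (neg (var (V.n i))) ∈ T) (hr : ∀ χ ∈ V.rangeLines L K, χ ∈ T) :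
    G.IsBlock T (V.highAll L K m) := by
  refine (ModAddU.AssocData.isBlock_flatten _ fun k hk => ?_).append
    (ModAddU.AssocData.isBlock_flatten _ fun k hk => ?_)
  · rw [List.length_map, List.length_range] at hk
    simp only [List.getElem_map, List.getElem_range]
    exact (isBlock_highLines hG (h.hCP (by omega)) hn (hr _ (mem_rangeLines_P (by omega)))).mono Set.subset_union_left
  · rw [List.length_map, List.length_range] at hk
    simp only [List.getElem_map, List.getElem_range]
    refine ((isBlock_highLines hG (h.hCD k hk) hn (hr _ (mem_rangeLines_D hk))).append
      ((isBlock_highLines hG (h.hCM k hk) hn (hr _ (mem_rangeLines_M hk))).mono Set.subset_union_left)).mono ?_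
    exact Set.subset_union_left.trans Set.subset_union_left

/-- Conclusions: the high bits of `P_s` are false. [folklore] -/
theorem mem_highAll_P {m s i : ℕ} (hs : s ≤ L) (hm : m ≤ i) (hi : i < L) :
    ctx K (neg (var (V.P L s i))) ∈ V.highAll L K m :=
  List.mem_append_left _ (List.mem_flatten.2 ⟨_, List.mem_map.2 ⟨s, List.mem_range.2 (by omega), rfl⟩,
    mem_highLines hm hi⟩)

/-- Conclusions: the high bits of `R(D_s)` are false. [folklore] -/
theorem mem_highAll_D {m s i : ℕ} (hs : s < L) (hm : m ≤ i) (hi : i < L) :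
    ctx K (neg (var ((V.Dv L s).R L i))) ∈ V.highAll L K m :=
  List.mem_append_right _ (List.mem_flatten.2 ⟨_, List.mem_map.2 ⟨s, List.mem_range.2 hs, rfl⟩,
    List.mem_append_left _ (mem_highLines hm hi)⟩)

/-- Conclusions: the high bits of `mk_s` are false. [folklore] -/
theorem mem_highAll_M {m s i : ℕ} (hs : s < L) (hm : m ≤ i) (hi : i < L) :
    ctx K (neg (var (V.msk L s i))) ∈ V.highAll L K m :=
  List.mem_append_right _ (List.mem_flatten.2 ⟨_, List.mem_map.2 ⟨s, List.mem_range.2 hs, rfl⟩,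
    List.mem_append_right _ (mem_highLines hm hi)⟩)

/-- Size of all the high lines. [folklore] -/
theorem proofSize_highAll (m : ℕ) : proofSize (V.highAll L K m) ≤ (3 * L + 1) * (2 * L * (K.size + 3)) := by
  rw [highAll, proofSize_append]
  have h₁ : proofSize ((List.range (L + 1)).map fun s => highLines (V.CP L s) K L m).flatten ≤
      (L + 1) * (2 * L * (K.size + 3)) := by
    rw [proofSize, List.map_flatten, List.sum_flatten, List.map_map]
    have := List.sum_le_card_nsmul (((List.range (L + 1)).map fun s => highLines (V.CP L s) K L m).map
      (fun l => (l.map PropForm.size).sum)) (2 * L * (K.size + 3)) (fun x hx => by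
        obtain ⟨l, hl, rfl⟩ := List.mem_map.1 hx
        obtain ⟨s, -, rfl⟩ := List.mem_map.1 hl
        exact proofSize_highLines _ _ _ _)
    simpa [Function.comp_def] using this
  have h₂ : proofSize ((List.range L).map fun s => highLines (V.CD L s) K L m ++ highLines (V.CM L s) K L m).flatten ≤
      L * (2 * (2 * L * (K.size + 3))) := by
    rw [proofSize, List.map_flatten, List.sum_flatten, List.map_map]
    have := List.sum_le_card_nsmul (((List.range L).map fun s => highLines (V.CD L s) K L m ++
      highLines (V.CM L s) K L m).map (fun l => (l.map PropForm.size).sum)) (2 * (2 * L * (K.size + 3))) (fun x hx => by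
        obtain ⟨l, hl, rfl⟩ := List.mem_map.1 hx
        obtain ⟨s, -, rfl⟩ := List.mem_map.1 hl
        have e := proofSize_highLines (V.CD L s) K L m
        have e' := proofSize_highLines (V.CM L s) K L m
        rw [proofSize] at e e'
        rw [List.map_append, List.sum_append]; omega)
    simpa [Function.comp_def] using this
  nlinarith [h₁, h₂]

end View

end ModMulU

end Literature.Computability.MetaComplexity
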